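/-
Copyright (c) 2026 the pub-hodgecm-mathlib formalisation cell (harness21).  Prover seat hodgecm-mathlib-K2E1-p13 (g0), Track B ∕ K2-LIT, h413 = `stmt-HodgeConjecture-24833`,
line `K2_E1_TraceFormulaBeta`, campaign «R8₂-sph EXHAUSTION», (69) f3-sph «inner product formula for spherical pseudo-Eisenstein series» FILE B = (GM) of K2E3-p12 (g7)'s census memo
`K2/K2E3-p12/g7/CENSUS-f3sph-PseudoEisensteinInnerProductCMTwo.K2E3-p12-g7.md` §4 (dealer K2E1-plan (g6) deal (88) 2026-09-04T10:41:05Z): the MELLIN REPRESENTATION of the standard intertwining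
integral of a radial section `f∘H` on `U(1,1)_{L∕L⁺}`.
-/
import Summits.HodgeConjecture.HodgeConjecture.Theorems.K2E1MellinPaleyWienerHalfLine           -- ★ A p859444 (K2E3-p12 g7): Mellin inversion in the `H^z` convention, vertical integrability, `mellin` entire
import Summits.HodgeConjecture.HodgeConjecture.Theorems.K2E1MaassSelbergSphericalBracketsCMTwo    -- ★ p858214∕… §1 `integral_borelHeight_weylLongU_mul_cpow_eq` (`∫ H(w₀vg)^w dν = c(w)·H(g)^{1−w}`, all `w`)
import Summits.HodgeConjecture.HodgeConjecture.Theorems.K2E1IntertwinedCoeffContinuousCMTwo       -- ★ p858082 (R6j)₂: Godement `integrable_borelHeight_weylLongU_mul_rpow_cm_two` (`σ > 1`)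
import Summits.HodgeConjecture.HodgeConjecture.Theorems.K2E1UnipotentHaarNormalisationU2         -- ★ p857675: `isInvInvariant_of_isHaarMeasure_two` (every Haar measure of the abelian `N(𝔸)` is inversion-invariant)
import HarnessLib

/-!
# R8₂-sph (69) f3-sph FILE B — `K2E1SphericalIntertwiningMellinCMTwo`: `∫_{N(𝔸)} f(H(w₀ v g)) dν(v) = (2π)⁻¹ ∫_ℝ f̃(z)·c(z)·H(g)^{1−z} dy` (`z = σ₀ + iy`, `σ₀ > 1`) for a radial
# section `f∘H`, `f ∈ C²_c((0,∞))`, on `U(1,1)_{L∕L⁺}` — the (GM) brick of the pseudo-Eisenstein inner-product formula [MW II.2.1]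

Track B ∕ K2-LIT, crux h413 = `stmt-HodgeConjecture-24833`, route of record `HCCMUnconditional`; cell `hodgecm-mathlib`, squad K2, ENGINE E1.  THEOREMS ONLY (no `def`, no `instance`,
no `notation`, no `sorry`; default heartbeats); lane `--supports stmt-HodgeConjecture-24833 --as helper` (count-neutral).
THE MATHEMATICS ([MoeglinWaldspurger1995, II.1.4, II.1.6, II.2.1]; [Garrett2018, §2.8, §1.12]; [Titchmarsh1948, Thm 71–72]).  For `f ∈ C²_c((0,∞))` Mellin inversion in the `H^z` convention
(★ A `eq_integral_cpow_mul_mellin_neg`) reads `f(r) = (2π)⁻¹∫_ℝ r^{σ₀+iy}·f̃(σ₀+iy) dy`, `f̃(z) := mellin f (−z)`, for EVERY `σ₀`.  Substituting `r = H(w₀ v g)` and integrating over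
`N(𝔸)`: for `σ₀ > 1` the double integrand has norm `H(w₀vg)^{σ₀}·‖f̃(σ₀+iy)‖`, the product of a `ν`-integrable function (Godement ★ `integrable_borelHeight_weylLongU_mul_rpow_cm_two`) and a
`dy`-integrable one (★ A `verticalIntegrable_mellin`), so Fubini applies (Mathlib `integral_integral_swap`), and the inner `v`-integral is the complex-exponent standard intertwining integral
★ `integral_borelHeight_weylLongU_mul_cpow_eq`: `∫ H(w₀vg)^z dν = c(z)·H(g)^{1−z}`, `c(z) = ∫_{N(𝔸)} H(w₀v)^z dν`.  HENCE (§1 HEAD) **`∫_{N(𝔸)} f(H(w₀vg)) dν = (2π)⁻¹ ∫_ℝ f̃(z)·c(z)·H(g)^{1−z} dy`**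
— EXACTLY the inner `(Mf)(r)` of ★ A's Parseval II (`setIntegral_mul_cpow_mul_conj_integral_eq`) at `r := H(g)`, so that with ★ R3 `borelConstantTerm_eisensteinSeriesU_two` the constant term of
the pseudo-Eisenstein series `θ_f` is `f∘H + (ν𝓕)⁻¹•(Mf)∘H` (FILE D).  §2 supplies Parseval II's two hypotheses on the line `Re = σ₀ > 1`: `y ↦ c(σ₀+iy)` is continuous (dominated convergence,
majorant `H(w₀v)^{σ₀}`) and bounded by `∫ H(w₀v)^{σ₀} dν = c(σ₀)`.
* §0 `sigmaFinite_haar_adelicUnipotent_cm_two`.  * §1 HEAD **`integral_comp_borelHeight_weylLongU_eq_mellin_cm_two`** (+ the Fubini integrability `integrable_cpow_mul_mellin_prod_cm_two`).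
* §2 `continuous_intertwiningScalar_vertical_cm_two`, `norm_intertwiningScalar_vertical_le_cm_two`.
HONEST LABEL: HC_CM is proved only modulo the 7 printed citations (2 remaining named inputs: hLiu418 = `stmt-HodgeConjecture-24832`, h413 = `stmt-HodgeConjecture-24833`) until rung 0
closes; this file asserts no named fact, closes no socket; count-neutral; letter-free (structural data `ν`, `𝓕` only).

## References
* [MoeglinWaldspurger1995] C. Mœglin, J.-L. Waldspurger, *Spectral decomposition and Eisenstein series* (1995), II.1.4 (Mellin∕pseudo-Eisenstein), II.1.6 (intertwining), II.2.1 (inner product formula).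
* [Garrett2018] P. Garrett, *Modern Analysis of Automorphic Forms by Example* (2018), §1.12, §2.8.
* [Titchmarsh1948] E. C. Titchmarsh, *Introduction to the Theory of Fourier Integrals* (1948), Thm 71–72 (Mellin inversion).
-/

set_option autoImplicit false
set_option linter.dupNamespace false  -- the mandated namespace repeats the summit's segment (`HodgeConjecture.HodgeConjecture`)

noncomputable section

open MeasureTheory Measure Set Filter Topology Complex NumberField IsDedekindDomain
open scoped Real NNReal
open Literature.NumberTheory.Automorphic Literature.NumberTheory.Automorphic.UnitaryGroup AdelicGroupData
open Summit.HodgeConjecture.HodgeConjecture.Cruxes.H413.K2E1MellinPaleyWienerHalfLine (eq_integral_cpow_mul_mellin_neg verticalIntegrable_mellin differentiable_mellin)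
open Summit.HodgeConjecture.HodgeConjecture.Cruxes.H413.K2E1MaassSelbergSphericalBracketsCMTwo (integral_borelHeight_weylLongU_mul_cpow_eq)
open Summit.HodgeConjecture.HodgeConjecture.Cruxes.H413.K2E1IntertwinedCoeffContinuousCMTwo (integrable_borelHeight_weylLongU_mul_rpow_cm_two)
open Summit.HodgeConjecture.HodgeConjecture.Cruxes.H413.K2E1UnipotentHaarNormalisationU2 (isInvInvariant_of_isHaarMeasure_two)

namespace Summit.HodgeConjecture.HodgeConjecture.Cruxes.H413.K2E1SphericalIntertwiningMellinCMTwo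

variable (L : Type) [Field L] [NumberField L] [IsCMField L]
variable [MeasurableSpace (quasiSplit (↥(maximalRealSubfield L)) L (IsCMField.complexConj L) 2).Adelic] [BorelSpace (quasiSplit (↥(maximalRealSubfield L)) L (IsCMField.complexConj L) 2).Adelic]

/-! ## §0 `N(𝔸)` is second countable locally compact, so a Haar measure on it is σ-finite (Fubini's standing hypothesis) -/

omit [BorelSpace (quasiSplit (↥(maximalRealSubfield L)) L (IsCMField.complexConj L) 2).Adelic] in
/-- A Haar measure on the unipotent radical `N(𝔸)` of `U(1,1)_{L∕L⁺}` is σ-finite: `N(𝔸)` is a closed subgroup (Mathlib `isClosed_upperUnitriangular`) of the second countable locally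
compact `G(𝔸)`, hence σ-compact. [cite: MoeglinWaldspurger1995, I.2.1] -/
theorem sigmaFinite_haar_adelicUnipotent_cm_two (ν : Measure ↥(adelicUnipotent (↥(maximalRealSubfield L)) L (IsCMField.complexConj L) 2)) [ν.IsHaarMeasure] : SigmaFinite ν := by
  haveI := secondCountableTopology_adeleRing L
  haveI := locallyCompactSpace_adeleRing' L
  haveI := t2Space_adeleRing_of_numberField L
  haveI : SecondCountableTopology (quasiSplit (↥(maximalRealSubfield L)) L (IsCMField.complexConj L) 2).Adelic := inferInstanceAs (SecondCountableTopology (adelic (↥(maximalRealSubfield L)) L (IsCMField.complexConj L) 2 ((StdForm.antidiagonal 2).over L)))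
  haveI : LocallyCompactSpace (quasiSplit (↥(maximalRealSubfield L)) L (IsCMField.complexConj L) 2).Adelic := inferInstanceAs (LocallyCompactSpace (adelic (↥(maximalRealSubfield L)) L (IsCMField.complexConj L) 2 ((StdForm.antidiagonal 2).over L)))
  have hcl : IsClosed ((adelicUnipotent (↥(maximalRealSubfield L)) L (IsCMField.complexConj L) 2 : Set (quasiSplit (↥(maximalRealSubfield L)) L (IsCMField.complexConj L) 2).Adelic)) := by
    change IsClosed (⇑(adelicVal (↥(maximalRealSubfield L)) L (IsCMField.complexConj L) 2 ((StdForm.antidiagonal 2).over L)) ⁻¹'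
      ((upperUnitriangular (Fin 2) (AdeleRing (𝓞 L) L) : Subgroup (GL (Fin 2) (AdeleRing (𝓞 L) L))) : Set (GL (Fin 2) (AdeleRing (𝓞 L) L))))
    exact (isClosed_upperUnitriangular (R := AdeleRing (𝓞 L) L)).preimage continuous_subtype_val
  haveI : LocallyCompactSpace ↥(adelicUnipotent (↥(maximalRealSubfield L)) L (IsCMField.complexConj L) 2) := hcl.locallyCompactSpace
  haveI : SecondCountableTopology ↥(adelicUnipotent (↥(maximalRealSubfield L)) L (IsCMField.complexConj L) 2) := TopologicalSpace.Subtype.secondCountableTopology _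
  infer_instance

/-! ## §1 The Mellin representation of the intertwining integral of a radial section -/

/-- **FUBINI INPUT**: for `σ₀ > 1`, `f ∈ C²_c((0,∞))` and every `g`, the double integrand `(v, y) ↦ H(w₀vg)^{σ₀+iy}·f̃(σ₀+iy)` (`f̃(z) = mellin f (−z)`) is integrable on `N(𝔸) × ℝ`: its
norm is `H(w₀vg)^{σ₀}·‖f̃(σ₀+iy)‖` (Mathlib `norm_cpow_eq_rpow_re_of_pos`), the product of the Godement-integrable ★ `integrable_borelHeight_weylLongU_mul_rpow_cm_two` and the
vertically integrable ★ `verticalIntegrable_mellin`. [cite: MoeglinWaldspurger1995, II.1.4, II.1.6] -/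
theorem integrable_cpow_mul_mellin_prod_cm_two
    (ν : Measure ↥(adelicUnipotent (↥(maximalRealSubfield L)) L (IsCMField.complexConj L) 2)) [ν.IsHaarMeasure] {𝓕 : Set ↥(adelicUnipotent (↥(maximalRealSubfield L)) L (IsCMField.complexConj L) 2)}
    (h𝓕N : IsFundamentalDomain ↥(rationalUnipotent (↥(maximalRealSubfield L)) L (IsCMField.complexConj L) 2) 𝓕 ν) (h𝓕c : IsCompact (closure 𝓕))
    {f : ℝ → ℂ} (hf : ContDiff ℝ 2 f) (hfs : HasCompactSupport f) (hf0 : tsupport f ⊆ Ioi 0) {σ₀ : ℝ} (hσ₀ : 1 < σ₀) (g : (quasiSplit (↥(maximalRealSubfield L)) L (IsCMField.complexConj L) 2).Adelic) :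
    Integrable (Function.uncurry fun (v : ↥(adelicUnipotent (↥(maximalRealSubfield L)) L (IsCMField.complexConj L) 2)) (y : ℝ) =>
      (((borelHeight ((quasiSplit (↥(maximalRealSubfield L)) L (IsCMField.complexConj L) 2).toAdelic (weylLongU ((IsCMField.complexConj L : L ≃ₐ[↥(maximalRealSubfield L)] L) : L →+* L) (rfl : (StdForm.antidiagonal 2).over L = (StdForm.antidiagonal 2).over L)) * ((v : (quasiSplit (↥(maximalRealSubfield L)) L (IsCMField.complexConj L) 2).Adelic) * g))) : ℝ) : ℂ) ^ ((σ₀ : ℂ) + y * I) * mellin f (-((σ₀ : ℂ) + y * I))) (ν.prod volume) := by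
  haveI := locallyCompactSpace_adeleRing' L
  haveI := sigmaFinite_haar_adelicUnipotent_cm_two L ν
  haveI : ν.IsInvInvariant := isInvInvariant_of_isHaarMeasure_two ν
  -- the two factors
  have hpos : ∀ v : ↥(adelicUnipotent (↥(maximalRealSubfield L)) L (IsCMField.complexConj L) 2), (0 : ℝ) < (borelHeight ((quasiSplit (↥(maximalRealSubfield L)) L (IsCMField.complexConj L) 2).toAdelic (weylLongU ((IsCMField.complexConj L : L ≃ₐ[↥(maximalRealSubfield L)] L) : L →+* L) (rfl : (StdForm.antidiagonal 2).over L = (StdForm.antidiagonal 2).over L)) * ((v : (quasiSplit (↥(maximalRealSubfield L)) L (IsCMField.complexConj L) 2).Adelic) * g)) : ℝ) := fun v => by exact_mod_cast borelHeight_pos _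
  have hGod := integrable_borelHeight_weylLongU_mul_rpow_cm_two L ν h𝓕N h𝓕c hσ₀ g
  have hFc : Continuous fun y : ℝ => mellin f (-((σ₀ : ℂ) + y * I)) := (differentiable_mellin hf.continuous hfs hf0).continuous.comp (by fun_prop)
  have hFi : Integrable fun y : ℝ => ‖mellin f (-((σ₀ : ℂ) + y * I))‖ := by
    have h := (verticalIntegrable_mellin hf hfs hf0 (-σ₀)).comp_neg
    refine (h.congr (Eventually.of_forall fun y => ?_)).norm
    show mellin f (((-σ₀ : ℝ) : ℂ) + ((-y : ℝ) : ℂ) * I) = mellin f (-((σ₀ : ℂ) + y * I))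
    congr 1; push_cast; ring
  have hprod : Integrable (fun p : ↥(adelicUnipotent (↥(maximalRealSubfield L)) L (IsCMField.complexConj L) 2) × ℝ => (borelHeight ((quasiSplit (↥(maximalRealSubfield L)) L (IsCMField.complexConj L) 2).toAdelic (weylLongU ((IsCMField.complexConj L : L ≃ₐ[↥(maximalRealSubfield L)] L) : L →+* L) (rfl : (StdForm.antidiagonal 2).over L = (StdForm.antidiagonal 2).over L)) * ((p.1 : (quasiSplit (↥(maximalRealSubfield L)) L (IsCMField.complexConj L) 2).Adelic) * g)) : ℝ) ^ σ₀ * ‖mellin f (-((σ₀ : ℂ) + p.2 * I))‖) (ν.prod volume) :=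
    hGod.mul_prod hFi
  -- measurability of the complex integrand (continuity) and the norm identity
  have hHc : Continuous fun v : ↥(adelicUnipotent (↥(maximalRealSubfield L)) L (IsCMField.complexConj L) 2) => (((borelHeight ((quasiSplit (↥(maximalRealSubfield L)) L (IsCMField.complexConj L) 2).toAdelic (weylLongU ((IsCMField.complexConj L : L ≃ₐ[↥(maximalRealSubfield L)] L) : L →+* L) (rfl : (StdForm.antidiagonal 2).over L = (StdForm.antidiagonal 2).over L)) * ((v : (quasiSplit (↥(maximalRealSubfield L)) L (IsCMField.complexConj L) 2).Adelic) * g))) : ℝ) : ℂ) :=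
    continuous_ofReal.comp (NNReal.continuous_coe.comp (continuous_borelHeight.comp (continuous_const.mul (continuous_subtype_val.mul continuous_const))))
  have hΦc : Continuous (Function.uncurry fun (v : ↥(adelicUnipotent (↥(maximalRealSubfield L)) L (IsCMField.complexConj L) 2)) (y : ℝ) =>
      (((borelHeight ((quasiSplit (↥(maximalRealSubfield L)) L (IsCMField.complexConj L) 2).toAdelic (weylLongU ((IsCMField.complexConj L : L ≃ₐ[↥(maximalRealSubfield L)] L) : L →+* L) (rfl : (StdForm.antidiagonal 2).over L = (StdForm.antidiagonal 2).over L)) * ((v : (quasiSplit (↥(maximalRealSubfield L)) L (IsCMField.complexConj L) 2).Adelic) * g))) : ℝ) : ℂ) ^ ((σ₀ : ℂ) + y * I) * mellin f (-((σ₀ : ℂ) + y * I))) := by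
    refine ((hHc.comp continuous_fst).cpow (by fun_prop) fun p => ?_).mul (hFc.comp continuous_snd)
    exact ofReal_mem_slitPlane.2 (hpos p.1)
  refine hprod.mono' hΦc.aestronglyMeasurable (Eventually.of_forall fun p => le_of_eq ?_)
  show ‖(((borelHeight ((quasiSplit (↥(maximalRealSubfield L)) L (IsCMField.complexConj L) 2).toAdelic (weylLongU ((IsCMField.complexConj L : L ≃ₐ[↥(maximalRealSubfield L)] L) : L →+* L) (rfl : (StdForm.antidiagonal 2).over L = (StdForm.antidiagonal 2).over L)) * ((p.1 : (quasiSplit (↥(maximalRealSubfield L)) L (IsCMField.complexConj L) 2).Adelic) * g))) : ℝ) : ℂ) ^ ((σ₀ : ℂ) + p.2 * I) * mellin f (-((σ₀ : ℂ) + p.2 * I))‖ = _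
  rw [norm_mul, norm_cpow_eq_rpow_re_of_pos (hpos p.1)]
  simp

/-- **HEAD — (GM): THE MELLIN REPRESENTATION OF THE STANDARD INTERTWINING INTEGRAL OF A RADIAL SECTION ON `U(1,1)_{L∕L⁺}`.**  For a Haar measure `ν` on `N(𝔸)` (with a relatively compact
fundamental domain `𝓕` of `N(L⁺)`, Godement's input), `f ∈ C²_c((0,∞))`, `σ₀ > 1` and every `g`:
**`∫_{N(𝔸)} f(H(w₀ v g)) dν(v) = (2π)⁻¹ ∫_ℝ f̃(σ₀+iy)·c(σ₀+iy)·H(g)^{1−(σ₀+iy)} dy`**, `f̃(z) = mellin f (−z)`, `c(z) = ∫_{N(𝔸)} H(w₀v)^z dν` — Mellin inversion ★ A under the `ν`-integral, Fubini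
(`integrable_cpow_mul_mellin_prod_cm_two`), and ★ `integral_borelHeight_weylLongU_mul_cpow_eq`.  This is the inner `(Mf)(r)` of ★ A's Parseval II at `r = H(g)`; with ★ R3 the constant term of
the radial pseudo-Eisenstein series is `θ_f,B = f∘H + (ν𝓕)⁻¹ • (Mf)∘H`. [cite: MoeglinWaldspurger1995, II.1.4, II.1.6, II.2.1] [cite: Garrett2018, §2.8] [cite: Titchmarsh1948, Thm 71–72] -/
theorem integral_comp_borelHeight_weylLongU_eq_mellin_cm_two
    (ν : Measure ↥(adelicUnipotent (↥(maximalRealSubfield L)) L (IsCMField.complexConj L) 2)) [ν.IsHaarMeasure] {𝓕 : Set ↥(adelicUnipotent (↥(maximalRealSubfield L)) L (IsCMField.complexConj L) 2)}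
    (h𝓕N : IsFundamentalDomain ↥(rationalUnipotent (↥(maximalRealSubfield L)) L (IsCMField.complexConj L) 2) 𝓕 ν) (h𝓕c : IsCompact (closure 𝓕))
    {f : ℝ → ℂ} (hf : ContDiff ℝ 2 f) (hfs : HasCompactSupport f) (hf0 : tsupport f ⊆ Ioi 0) {σ₀ : ℝ} (hσ₀ : 1 < σ₀) (g : (quasiSplit (↥(maximalRealSubfield L)) L (IsCMField.complexConj L) 2).Adelic) :
    ∫ v : ↥(adelicUnipotent (↥(maximalRealSubfield L)) L (IsCMField.complexConj L) 2), f ((borelHeight ((quasiSplit (↥(maximalRealSubfield L)) L (IsCMField.complexConj L) 2).toAdelic (weylLongU ((IsCMField.complexConj L : L ≃ₐ[↥(maximalRealSubfield L)] L) : L →+* L) (rfl : (StdForm.antidiagonal 2).over L = (StdForm.antidiagonal 2).over L)) * ((v : (quasiSplit (↥(maximalRealSubfield L)) L (IsCMField.complexConj L) 2).Adelic) * g))) : ℝ) ∂ν =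
      (((2 * π)⁻¹ : ℝ) : ℂ) * ∫ y : ℝ, mellin f (-((σ₀ : ℂ) + y * I)) * (∫ v : ↥(adelicUnipotent (↥(maximalRealSubfield L)) L (IsCMField.complexConj L) 2), (((borelHeight ((quasiSplit (↥(maximalRealSubfield L)) L (IsCMField.complexConj L) 2).toAdelic (weylLongU ((IsCMField.complexConj L : L ≃ₐ[↥(maximalRealSubfield L)] L) : L →+* L) (rfl : (StdForm.antidiagonal 2).over L = (StdForm.antidiagonal 2).over L)) * (v : (quasiSplit (↥(maximalRealSubfield L)) L (IsCMField.complexConj L) 2).Adelic))) : ℝ) : ℂ) ^ (((σ₀ : ℂ) + y * I)) ∂ν) * (((borelHeight g : ℝ)) : ℂ) ^ (1 - ((σ₀ : ℂ) + y * I)) := by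
  have hc : IsCMField.complexConj L * IsCMField.complexConj L = 1 := AlgEquiv.ext fun x => IsCMField.complexConj_apply_apply L x
  have hc1 : IsCMField.complexConj L ≠ 1 := IsCMField.complexConj_ne_one L
  have hBK := exists_mem_borelAdelic_mul_mem_standardMaximalCompactGL_cm L (N := 2)
  have hpos : ∀ v : ↥(adelicUnipotent (↥(maximalRealSubfield L)) L (IsCMField.complexConj L) 2), (0 : ℝ) < (borelHeight ((quasiSplit (↥(maximalRealSubfield L)) L (IsCMField.complexConj L) 2).toAdelic (weylLongU ((IsCMField.complexConj L : L ≃ₐ[↥(maximalRealSubfield L)] L) : L →+* L) (rfl : (StdForm.antidiagonal 2).over L = (StdForm.antidiagonal 2).over L)) * ((v : (quasiSplit (↥(maximalRealSubfield L)) L (IsCMField.complexConj L) 2).Adelic) * g)) : ℝ) := fun v => by exact_mod_cast borelHeight_pos _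
  haveI := sigmaFinite_haar_adelicUnipotent_cm_two L ν
  have hΦi := integrable_cpow_mul_mellin_prod_cm_two L ν h𝓕N h𝓕c hf hfs hf0 hσ₀ g
  -- (1) Mellin inversion under the `ν`-integral
  have hinv : (fun v : ↥(adelicUnipotent (↥(maximalRealSubfield L)) L (IsCMField.complexConj L) 2) => f ((borelHeight ((quasiSplit (↥(maximalRealSubfield L)) L (IsCMField.complexConj L) 2).toAdelic (weylLongU ((IsCMField.complexConj L : L ≃ₐ[↥(maximalRealSubfield L)] L) : L →+* L) (rfl : (StdForm.antidiagonal 2).over L = (StdForm.antidiagonal 2).over L)) * ((v : (quasiSplit (↥(maximalRealSubfield L)) L (IsCMField.complexConj L) 2).Adelic) * g))) : ℝ)) =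
      fun v : ↥(adelicUnipotent (↥(maximalRealSubfield L)) L (IsCMField.complexConj L) 2) => (((2 * π)⁻¹ : ℝ) : ℂ) * ∫ y : ℝ, (((borelHeight ((quasiSplit (↥(maximalRealSubfield L)) L (IsCMField.complexConj L) 2).toAdelic (weylLongU ((IsCMField.complexConj L : L ≃ₐ[↥(maximalRealSubfield L)] L) : L →+* L) (rfl : (StdForm.antidiagonal 2).over L = (StdForm.antidiagonal 2).over L)) * ((v : (quasiSplit (↥(maximalRealSubfield L)) L (IsCMField.complexConj L) 2).Adelic) * g))) : ℝ) : ℂ) ^ ((σ₀ : ℂ) + y * I) * mellin f (-((σ₀ : ℂ) + y * I)) :=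
    funext fun v => eq_integral_cpow_mul_mellin_neg hf hfs hf0 σ₀ (hpos v)
  rw [hinv, integral_const_mul]
  congr 1
  -- (2) Fubini over `N(𝔸) × ℝ`
  rw [integral_integral_swap hΦi]
  refine integral_congr_ae (Eventually.of_forall fun y => ?_)
  -- (3) the inner integral is the complex-exponent intertwining integral
  show ∫ v : ↥(adelicUnipotent (↥(maximalRealSubfield L)) L (IsCMField.complexConj L) 2), (((borelHeight ((quasiSplit (↥(maximalRealSubfield L)) L (IsCMField.complexConj L) 2).toAdelic (weylLongU ((IsCMField.complexConj L : L ≃ₐ[↥(maximalRealSubfield L)] L) : L →+* L) (rfl : (StdForm.antidiagonal 2).over L = (StdForm.antidiagonal 2).over L)) * ((v : (quasiSplit (↥(maximalRealSubfield L)) L (IsCMField.complexConj L) 2).Adelic) * g))) : ℝ) : ℂ) ^ ((σ₀ : ℂ) + y * I) * mellin f (-((σ₀ : ℂ) + y * I)) ∂ν = _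
  rw [integral_mul_const, integral_borelHeight_weylLongU_mul_cpow_eq hc hc1 ν hBK ((σ₀ : ℂ) + y * I) g]
  ring

/-! ## §2 The scalar `c` on the line `Re z = σ₀ > 1`: continuity and the bound `‖c(σ₀+iy)‖ ≤ c(σ₀)` (Parseval II's hypotheses) -/

omit [BorelSpace (quasiSplit (↥(maximalRealSubfield L)) L (IsCMField.complexConj L) 2).Adelic] in
/-- **`‖c(σ₀+iy)‖ ≤ ∫ H(w₀v)^{σ₀} dν`** for every `σ₀, y` and every measure `ν` (`‖H^{σ₀+iy}‖ = H^{σ₀}`; for `σ₀ > 1` and Haar `ν` the right side is the finite `c(σ₀)`). [cite: MoeglinWaldspurger1995, II.1.6] -/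
theorem norm_intertwiningScalar_vertical_le_cm_two (ν : Measure ↥(adelicUnipotent (↥(maximalRealSubfield L)) L (IsCMField.complexConj L) 2)) (σ₀ y : ℝ) :
    ‖(∫ v : ↥(adelicUnipotent (↥(maximalRealSubfield L)) L (IsCMField.complexConj L) 2), (((borelHeight ((quasiSplit (↥(maximalRealSubfield L)) L (IsCMField.complexConj L) 2).toAdelic (weylLongU ((IsCMField.complexConj L : L ≃ₐ[↥(maximalRealSubfield L)] L) : L →+* L) (rfl : (StdForm.antidiagonal 2).over L = (StdForm.antidiagonal 2).over L)) * (v : (quasiSplit (↥(maximalRealSubfield L)) L (IsCMField.complexConj L) 2).Adelic))) : ℝ) : ℂ) ^ (((σ₀ : ℂ) + y * I)) ∂ν)‖ ≤ ∫ v : ↥(adelicUnipotent (↥(maximalRealSubfield L)) L (IsCMField.complexConj L) 2), ((borelHeight ((quasiSplit (↥(maximalRealSubfield L)) L (IsCMField.complexConj L) 2).toAdelic (weylLongU ((IsCMField.complexConj L : L ≃ₐ[↥(maximalRealSubfield L)] L) : L →+* L) (rfl : (StdForm.antidiagonal 2).over L = (StdForm.antidiagonal 2).over L)) * (v : (quasiSplit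 (↥(maximalRealSubfield L)) L (IsCMField.complexConj L) 2).Adelic))) : ℝ) ^ σ₀ ∂ν := by
  have hpos : ∀ v : ↥(adelicUnipotent (↥(maximalRealSubfield L)) L (IsCMField.complexConj L) 2), (0 : ℝ) < (borelHeight ((quasiSplit (↥(maximalRealSubfield L)) L (IsCMField.complexConj L) 2).toAdelic (weylLongU ((IsCMField.complexConj L : L ≃ₐ[↥(maximalRealSubfield L)] L) : L →+* L) (rfl : (StdForm.antidiagonal 2).over L = (StdForm.antidiagonal 2).over L)) * (v : (quasiSplit (↥(maximalRealSubfield L)) L (IsCMField.complexConj L) 2).Adelic)) : ℝ) := fun v => by exact_mod_cast borelHeight_pos _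
  refine (norm_integral_le_integral_norm _).trans (le_of_eq (integral_congr_ae (Eventually.of_forall fun v => ?_)))
  show ‖(((borelHeight ((quasiSplit (↥(maximalRealSubfield L)) L (IsCMField.complexConj L) 2).toAdelic (weylLongU ((IsCMField.complexConj L : L ≃ₐ[↥(maximalRealSubfield L)] L) : L →+* L) (rfl : (StdForm.antidiagonal 2).over L = (StdForm.antidiagonal 2).over L)) * (v : (quasiSplit (↥(maximalRealSubfield L)) L (IsCMField.complexConj L) 2).Adelic))) : ℝ) : ℂ) ^ ((σ₀ : ℂ) + y * I)‖ = _
  rw [norm_cpow_eq_rpow_re_of_pos (hpos v)]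
  simp

/-- **`y ↦ c(σ₀+iy)` IS CONTINUOUS** for `σ₀ > 1` — dominated convergence (Mathlib `continuous_of_dominated`) with the Godement majorant `H(w₀v)^{σ₀}` (★
`integrable_borelHeight_weylLongU_mul_rpow_cm_two` at `g = 1`). [cite: MoeglinWaldspurger1995, II.1.6] -/
theorem continuous_intertwiningScalar_vertical_cm_two
    (ν : Measure ↥(adelicUnipotent (↥(maximalRealSubfield L)) L (IsCMField.complexConj L) 2)) [ν.IsHaarMeasure] {𝓕 : Set ↥(adelicUnipotent (↥(maximalRealSubfield L)) L (IsCMField.complexConj L) 2)}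
    (h𝓕N : IsFundamentalDomain ↥(rationalUnipotent (↥(maximalRealSubfield L)) L (IsCMField.complexConj L) 2) 𝓕 ν) (h𝓕c : IsCompact (closure 𝓕))
    {σ₀ : ℝ} (hσ₀ : 1 < σ₀) :
    Continuous fun y : ℝ => (∫ v : ↥(adelicUnipotent (↥(maximalRealSubfield L)) L (IsCMField.complexConj L) 2), (((borelHeight ((quasiSplit (↥(maximalRealSubfield L)) L (IsCMField.complexConj L) 2).toAdelic (weylLongU ((IsCMField.complexConj L : L ≃ₐ[↥(maximalRealSubfield L)] L) : L →+* L) (rfl : (StdForm.antidiagonal 2).over L = (StdForm.antidiagonal 2).over L)) * (v : (quasiSplit (↥(maximalRealSubfield L)) L (IsCMField.complexConj L) 2).Adelic))) : ℝ) : ℂ) ^ (((σ₀ : ℂ) + y * I)) ∂ν) := by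
  haveI := locallyCompactSpace_adeleRing' L
  haveI : ν.IsInvInvariant := isInvInvariant_of_isHaarMeasure_two ν
  have hpos : ∀ v : ↥(adelicUnipotent (↥(maximalRealSubfield L)) L (IsCMField.complexConj L) 2), (0 : ℝ) < (borelHeight ((quasiSplit (↥(maximalRealSubfield L)) L (IsCMField.complexConj L) 2).toAdelic (weylLongU ((IsCMField.complexConj L : L ≃ₐ[↥(maximalRealSubfield L)] L) : L →+* L) (rfl : (StdForm.antidiagonal 2).over L = (StdForm.antidiagonal 2).over L)) * (v : (quasiSplit (↥(maximalRealSubfield L)) L (IsCMField.complexConj L) 2).Adelic)) : ℝ) := fun v => by exact_mod_cast borelHeight_pos _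
  have hGod : Integrable (fun v : ↥(adelicUnipotent (↥(maximalRealSubfield L)) L (IsCMField.complexConj L) 2) => ((borelHeight ((quasiSplit (↥(maximalRealSubfield L)) L (IsCMField.complexConj L) 2).toAdelic (weylLongU ((IsCMField.complexConj L : L ≃ₐ[↥(maximalRealSubfield L)] L) : L →+* L) (rfl : (StdForm.antidiagonal 2).over L = (StdForm.antidiagonal 2).over L)) * (v : (quasiSplit (↥(maximalRealSubfield L)) L (IsCMField.complexConj L) 2).Adelic))) : ℝ) ^ σ₀) ν := by
    have h := integrable_borelHeight_weylLongU_mul_rpow_cm_two L ν h𝓕N h𝓕c hσ₀ 1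
    simpa only [mul_one] using h
  have hHc : Continuous fun v : ↥(adelicUnipotent (↥(maximalRealSubfield L)) L (IsCMField.complexConj L) 2) => (((borelHeight ((quasiSplit (↥(maximalRealSubfield L)) L (IsCMField.complexConj L) 2).toAdelic (weylLongU ((IsCMField.complexConj L : L ≃ₐ[↥(maximalRealSubfield L)] L) : L →+* L) (rfl : (StdForm.antidiagonal 2).over L = (StdForm.antidiagonal 2).over L)) * (v : (quasiSplit (↥(maximalRealSubfield L)) L (IsCMField.complexConj L) 2).Adelic))) : ℝ) : ℂ) :=
    continuous_ofReal.comp (NNReal.continuous_coe.comp (continuous_borelHeight.comp (continuous_const.mul continuous_subtype_val)))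
  refine continuous_of_dominated (fun y => ?_) (fun y => Eventually.of_forall fun v => ?_) hGod (Eventually.of_forall fun v => ?_)
  · exact (hHc.cpow continuous_const fun v => ofReal_mem_slitPlane.2 (hpos v)).aestronglyMeasurable
  · rw [norm_cpow_eq_rpow_re_of_pos (hpos v)]
    simp
  · exact continuous_const.cpow (by fun_prop) fun _ => ofReal_mem_slitPlane.2 (hpos v)

end Summit.HodgeConjecture.HodgeConjecture.Cruxes.H413.K2E1SphericalIntertwiningMellinCMTwo

end
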